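import Literature.Topology.FourManifolds.CorkDecompositionSplittingProof
import Literature.Topology.FourManifolds.BoundaryConnectedSumProofs
import Literature.Topology.FourManifolds.OrientedConnectedSumUniqueness
import Literature.Topology.FourManifolds.OrientedConnectedSumTransportProofs
import Literature.Topology.FourManifolds.HalfDiscFromCollar
import Literature.Topology.FourManifolds.CollarTheorem
import Literature.Topology.FourManifolds.BCSBoundaryOrientation
import Literature.Topology.FourManifolds.ClosedModelHomology
import Literature.Topology.FourManifolds.HomotopySpheresSignature
import Mathlib.Analysis.Convex.Contractible
import HarnessLib

/-!
# The boundary connected sum of two null-cobordisms of homotopy spheres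

M. Kervaire, J. Milnor, *Groups of homotopy spheres I*, Ann. of Math. 77 (1963), §2, p. 508,
Lemma 2.2 and its Addendum: if `M₁ = bW₁`, `M₂ = bW₂`, the connected sum along the boundary
`W = W₁ ♮ W₂` (glue half-discs `(H, D) ↪ (Wᵢ, bWᵢ)` whose flat faces are the discs of the
connected sum `M₁ # M₂`) is a smooth compact manifold with `bW = M₁ # M₂`.

This file CONSTRUCTS `W_U = W_S ♮ W_T` for null-cobordisms `W_S`, `W_T` of homotopy spheres `S`,
`T` and an oriented connected sum `U = S # T`, and packages the output in the form consumed by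
the homological files (`BCSOrientationGluing`, `BCSBoundaryOrientation`,
`BCSSignatureAdditivity`): a null-cobordism `cU : NullCobordism (n+1) U.carrier` with
`cU.W = W_U`, the two open pieces `W_S ∖ {pt}`, `W_T ∖ {pt}` embedded in `W_U` (`BCSGluing`), the
boundary links identifying `∂W_U` with `S # T = U` (`BdryLink`, with the ORIGINAL gluing maps of
`U` as the boundary maps), and the geometric facts: the punctures are boundary points, the glued
region lies in the collars, the interior overlap is an open half-ball (contractible).

Construction (Kervaire–Milnor 1963, §2; Kosinski 1993, VI.5; Juhász 2023, Def. 1.47): the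
half-discs are the collar half-discs over the discs `i₁`, `i₂` of `U = S # T`
(`BoundaryData.Collar.halfDisc`, Hirsch 1976, §4.6); `W_U` is the pushout along Juhász's
relation (`HalfDiscPair.exists_isOpenGluing`); its boundary datum is `∂W_S # ∂W_T`
(`SplitPiece.boundaryData`, the Matveyev-splitting toolkit of the tree), which is identified with
`U` by the uniqueness of open gluings (`IsOpenGluing.exists_diffeomorph_comp_eq`).

* `HomotopySphere.BCSModel S T U cS cT` — the packaged output;
* `HomotopySphere.nonempty_bcsModel` — its construction from `IsOrientedConnectedSum`.

Everything is proved; no named facts.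

## References

* M. A. Kervaire, J. W. Milnor, *Groups of homotopy spheres: I*, Ann. of Math. (2) 77 (1963),
  §2 p. 508, Lemma 2.2 and Addendum. [KervaireMilnorAnnals1963]
* A. A. Kosinski, *Differential Manifolds*, Academic Press 1993, VI.5. [Kosinski1993]
* A. Juhász, *Differential and Low-Dimensional Topology*, CUP 2023, Def. 1.47. [Juhasz2023]
* M. W. Hirsch, *Differential Topology*, Springer 1976, §4.6. [Hirsch1976]
-/

noncomputable section

open scoped Manifold ContDiff Topology
open Set Function Topology TopologicalSpace
open Literature.AlgebraicTopology.SingularHomology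

namespace Literature.Topology.FourManifolds

namespace HomotopySphere

variable {n : ℕ} (S T U : HomotopySphere (n + 1))
  (cS : NullCobordism (n + 1) S.carrier) (cT : NullCobordism (n + 1) T.carrier)

/-- **The packaged boundary connected sum `W_U = W_S ♮ W_T`** of two null-cobordisms of homotopy
spheres over an oriented connected sum `U = S # T` (Kervaire–Milnor 1963, §2 p. 508): the
null-cobordism `cU` of `U`, the gluing of the punctured pieces (`G`), the boundary links whose
boundary maps are gluing maps of `U` (`LS`, `LT`, on nonempty domains) preserving the
orientations, collars of `W_S`, `W_T` containing the glued regions, and the contractibility of the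
interior overlap.
[cite: KervaireMilnorAnnals1963, §2 p. 508] -/
structure BCSModel where
  /-- a collar of `W_S` -/
  κS : cS.boundaryData.Collar
  /-- a collar of `W_T` -/
  κT : cT.boundaryData.Collar
  /-- the boundary connected sum, bounding `U` -/
  cU : NullCobordism (n + 1) U.carrier
  /-- the gluing of the punctured pieces -/
  G : NullCobordism.BCSGluing cS cT cU
  /-- the boundary link on the `S` side -/
  LS : G.S.BdryLink
  /-- the boundary link on the `T` side -/
  LT : G.T.BdryLink
  hopS : IsOrientationPreserving (S.orientation.restrict LS.A') U.orientation LS.j'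
  hopT : IsOrientationPreserving (T.orientation.restrict LT.A') U.orientation LT.j'
  nonempty_linkS : Nonempty LS.A'
  nonempty_linkT : Nonempty LT.A'
  containsS : ∀ x : cS.W, x ∈ (𝓡∂ (n + 1 + 1)).interior cS.W → x ∈ G.S.A
  containsT : ∀ x : cT.W, x ∈ (𝓡∂ (n + 1 + 1)).interior cT.W → x ∈ G.T.A
  collarS : ∀ x : G.S.A, G.S.j x ∈ range G.T.j → (x : cS.W) ∈ cS.collarNhd κS 1
  collarT : ∀ y : G.T.A, G.T.j y ∈ range G.S.j → (y : cT.W) ∈ cT.collarNhd κT 1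
  contractible_overlap : ContractibleSpace
    ↥{z : ManifoldInterior (n + 1) cU.W | z.1 ∈ range G.S.j ∩ range G.T.j}

end HomotopySphere

/-! ### The construction -/

namespace NullCobordism

/-- The punctured piece of a manifold with two points is nonempty. [folklore] -/
instance nonempty_puncture {X M : Type*} [Zero X] [TopologicalSpace M] [T1Space M] [Nontrivial M]
    (k : X → M) : Nonempty ↥(puncture k) := by
  obtain ⟨x, hx⟩ := exists_ne (k 0)
  exact ⟨⟨x, hx⟩⟩

/-- A null-cobordism of a nonempty manifold has at least two points (the two ends of a collar
line). [folklore] -/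
theorem nontrivial_W {n : ℕ} {M : Type} [TopologicalSpace M] [ChartedSpace (EuclideanSpace ℝ (Fin (n + 1))) M]
    [IsManifold (𝓡 (n + 1)) ∞ M] [Nonempty M] (c : NullCobordism (n + 1) M) : Nontrivial c.W := by
  obtain ⟨κ⟩ := BoundaryData.nonempty_collar_of_compactSpace n c.W c.boundaryData
  obtain ⟨x⟩ := (inferInstance : Nonempty M)
  refine ⟨⟨κ (x, ⊥), κ (x, ⊤), fun h => ?_⟩⟩
  have h1 := congrArg Prod.snd (κ.injective h)
  exact bot_ne_top h1

/-- **The data of the boundary connected sum construction** (Kervaire–Milnor 1963, §2 p. 508;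
Juhász 2023, Def. 1.47): two null-cobordisms `W_S`, `W_T` of closed manifolds `M_S`, `M_T` with
collars, discs `i_S`, `i_T` of `M_S`, `M_T`, the glued manifold `P = W_S ♮ W_T` along the collar
half-discs over the discs (`W`), connected sum data of `M_S # M_T` with these discs (`Dσ`), a
manifold `M_U` glued from `M_S ∖ pt`, `M_T ∖ pt` by `jA`, `jB` along the connected sum relation,
and its identification `Ψ` with `M_S # M_T` compatible with the gluing maps. [cite: KervaireMilnorAnnals1963, §2 p. 508] -/
structure BCSSetup (n : ℕ) where
  /-- the first boundary manifold -/
  MS : Type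
  /-- the second boundary manifold -/
  MT : Type
  /-- the glued boundary manifold -/
  MU : Type
  [topMS : TopologicalSpace MS]
  [chartMS : ChartedSpace (EuclideanSpace ℝ (Fin (n + 1))) MS]
  [manifoldMS : IsManifold (𝓡 (n + 1)) ∞ MS]
  [compactMS : CompactSpace MS]
  [t2MS : T2Space MS]
  [nonemptyMS : Nonempty MS]
  [topMT : TopologicalSpace MT]
  [chartMT : ChartedSpace (EuclideanSpace ℝ (Fin (n + 1))) MT]
  [manifoldMT : IsManifold (𝓡 (n + 1)) ∞ MT]
  [compactMT : CompactSpace MT]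
  [t2MT : T2Space MT]
  [nonemptyMT : Nonempty MT]
  [topMU : TopologicalSpace MU]
  [chartMU : ChartedSpace (EuclideanSpace ℝ (Fin (n + 1))) MU]
  [manifoldMU : IsManifold (𝓡 (n + 1)) ∞ MU]
  /-- the first null-cobordism -/
  cS : NullCobordism (n + 1) MS
  /-- the second null-cobordism -/
  cT : NullCobordism (n + 1) MT
  /-- a collar of `W_S` -/
  κS : cS.boundaryData.Collar
  /-- a collar of `W_T` -/
  κT : cT.boundaryData.Collar
  /-- the disc of `M_S` -/
  iS : EuclideanSpace ℝ (Fin (n + 1)) → MS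
  /-- the disc of `M_T` -/
  iT : EuclideanSpace ℝ (Fin (n + 1)) → MT
  hiS : Manifold.IsSmoothEmbedding (𝓡 (n + 1)) (𝓡 (n + 1)) ∞ iS
  hiT : Manifold.IsSmoothEmbedding (𝓡 (n + 1)) (𝓡 (n + 1)) ∞ iT
  /-- the glued manifold `W_S ♮ W_T` -/
  P : Type
  [topP : TopologicalSpace P]
  [t2P : T2Space P]
  [secondP : SecondCountableTopology P]
  [chartP : ChartedSpace (EuclideanHalfSpace (n + 2)) P]
  [manifoldP : IsManifold (𝓡∂ (n + 2)) ∞ P]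
  [compactP : CompactSpace P]
  /-- the open gluing of the punctured pieces along the collar half-discs -/
  W : HalfGluing (κS.halfDisc iS) (κT.halfDisc iT) P
  /-- connected sum data of `M_S # M_T` along the discs -/
  Dσ : ConnectedSumData (n + 1) MS MT
  hD₁ : Dσ.i₁ = iS
  hD₂ : Dσ.i₂ = iT
  /-- the gluing maps of `M_U` -/
  jA : ↥(puncture iS) → MU
  /-- the gluing maps of `M_U` -/
  jB : ↥(puncture iT) → MU
  hjA : Manifold.IsSmoothEmbedding (𝓡 (n + 1)) (𝓡 (n + 1)) ∞ jA
  hjAo : IsOpen (range jA)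
  hjB : Manifold.IsSmoothEmbedding (𝓡 (n + 1)) (𝓡 (n + 1)) ∞ jB
  hjBo : IsOpen (range jB)
  /-- the identification `M_U ≅ M_S # M_T` -/
  Ψ : MU ≃ₘ⟮𝓡 (n + 1), 𝓘(ℝ, EuclideanSpace ℝ (Fin (n + 1)))⟯ (Dσ.glueData (Nat.succ_ne_zero n)).Glued
  hΨA : ∀ a : ↥(puncture iS),
    Ψ (jA a) = (Dσ.glueData (Nat.succ_ne_zero n)).inl ⟨a.1, by rw [mem_puncture, hD₁]; exact a.2⟩
  hΨB : ∀ b : ↥(puncture iT),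
    Ψ (jB b) = (Dσ.glueData (Nat.succ_ne_zero n)).inr ⟨b.1, by rw [mem_puncture, hD₂]; exact b.2⟩

attribute [instance] BCSSetup.topMS BCSSetup.chartMS BCSSetup.manifoldMS BCSSetup.compactMS
  BCSSetup.t2MS BCSSetup.nonemptyMS BCSSetup.topMT BCSSetup.chartMT BCSSetup.manifoldMT
  BCSSetup.compactMT BCSSetup.t2MT BCSSetup.nonemptyMT BCSSetup.topMU BCSSetup.chartMU
  BCSSetup.manifoldMU BCSSetup.topP BCSSetup.t2P BCSSetup.secondP BCSSetup.chartP
  BCSSetup.manifoldP BCSSetup.compactP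

namespace BCSSetup

variable {n : ℕ} (X : BCSSetup n)

/-- `W_S` has two points. [folklore] -/
instance instNontrivialWS : Nontrivial X.cS.W := nontrivial_W X.cS

/-- `W_T` has two points. [folklore] -/
instance instNontrivialWT : Nontrivial X.cT.W := nontrivial_W X.cT

/-! ### The half-discs -/

/-- The collar half-disc over the disc `i_S` of `M_S`. [cite: Hirsch1976, §4.6] -/
abbrev kS : EuclideanHalfSpace (n + 2) → X.cS.W := X.κS.halfDisc X.iS

/-- The collar half-disc over the disc `i_T` of `M_T`. [cite: Hirsch1976, §4.6] -/
abbrev kT : EuclideanHalfSpace (n + 2) → X.cT.W := X.κT.halfDisc X.iT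

/-- The half-disc over `i_S` is a smooth embedding with open range. [cite: Hirsch1976, §4.6] -/
theorem isSmoothEmbedding_kS :
    Manifold.IsSmoothEmbedding (𝓡∂ (n + 2)) (𝓡∂ (n + 2)) ∞ X.kS ∧ IsOpen (range X.kS) :=
  X.κS.isSmoothEmbedding_halfDisc X.hiS (isOpen_range_of_isSmoothEmbedding_disc X.hiS)

/-- The half-disc over `i_T` is a smooth embedding with open range. [cite: Hirsch1976, §4.6] -/
theorem isSmoothEmbedding_kT :
    Manifold.IsSmoothEmbedding (𝓡∂ (n + 2)) (𝓡∂ (n + 2)) ∞ X.kT ∧ IsOpen (range X.kT) :=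
  X.κT.isSmoothEmbedding_halfDisc X.hiT (isOpen_range_of_isSmoothEmbedding_disc X.hiT)

/-- The half-disc lies in the collar neighbourhood `κ(∂W_S × [0, 1))`. [cite: Hirsch1976, §4.6] -/
theorem kS_mem_collarNhd (v : EuclideanHalfSpace (n + 2)) : X.kS v ∈ X.cS.collarNhd X.κS 1 := by
  rw [kS, BoundaryData.Collar.halfDisc_apply]
  exact (X.cS.collar_mem_collarNhd_iff X.κS _).2 (halfDiscLift_snd_lt_one (b := X.cS.boundaryData) X.iS v)

/-- The half-disc lies in the collar neighbourhood `κ(∂W_T × [0, 1))`. [cite: Hirsch1976, §4.6] -/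
theorem kT_mem_collarNhd (v : EuclideanHalfSpace (n + 2)) : X.kT v ∈ X.cT.collarNhd X.κT 1 := by
  rw [kT, BoundaryData.Collar.halfDisc_apply]
  exact (X.cT.collar_mem_collarNhd_iff X.κT _).2 (halfDiscLift_snd_lt_one (b := X.cT.boundaryData) X.iT v)

/-- The piece `W_S` with its boundary `M_S`, half-disc `k_S` and face disc `i_S`. [folklore] -/
def pS : SplitPiece n X.MS X.cS.W :=
  ⟨X.iS, X.kS, X.cS.incl, X.hiS, isOpen_range_of_isSmoothEmbedding_disc X.hiS,
    X.isSmoothEmbedding_kS.1, X.isSmoothEmbedding_kS.2, X.cS.isSmoothEmbedding_incl,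
    X.cS.range_incl, X.κS.halfDisc_face X.iS⟩

/-- The piece `W_T` with its boundary `M_T`, half-disc `k_T` and face disc `i_T`. [folklore] -/
def pT : SplitPiece n X.MT X.cT.W :=
  ⟨X.iT, X.kT, X.cT.incl, X.hiT, isOpen_range_of_isSmoothEmbedding_disc X.hiT,
    X.isSmoothEmbedding_kT.1, X.isSmoothEmbedding_kT.2, X.cT.isSmoothEmbedding_incl,
    X.cT.range_incl, X.κT.halfDisc_face X.iT⟩

/-! ### The glued manifold as a null-cobordism of `M_U` -/

/-- The boundary datum `∂(W_S ♮ W_T) = M_S # M_T` of the glued manifold (`SplitPiece.boundaryData`).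
[cite: Juhasz2023, Def. 1.47] -/
def bdry : BoundaryData (𝓡∂ (n + 2)) X.P (𝓡 (n + 1)) :=
  SplitPiece.boundaryData X.Dσ X.pS X.pT X.hD₁ X.hD₂ X.W (Nat.succ_ne_zero n)

/-- **The boundary connected sum as a null-cobordism of `M_U ≅ M_S # M_T`**: `W := W_S ♮ W_T`,
`incl := (boundary map) ∘ Ψ`. [cite: KervaireMilnorAnnals1963, §2 p. 508] -/
def glued : NullCobordism (n + 1) X.MU where
  W := X.P
  incl := X.bdry.incl ∘ X.Ψ
  isSmoothEmbedding_incl := X.bdry.isSmoothEmbedding.comp_diffeomorph X.Ψ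
  range_incl :=
    have hΨ : Surjective (fun u : X.MU => X.Ψ u) := fun y => ⟨X.Ψ.symm y, X.Ψ.apply_symm_apply y⟩
    (hΨ.range_comp X.bdry.incl).trans X.bdry.range_incl

/-- The boundary inclusion of the glued null-cobordism on the `S`-part of `M_U`:
`incl_U (jA a) = ι₁ (incl_S a)`. [folklore] -/
theorem glued_incl_jA (a : ↥(puncture X.iS)) :
    X.glued.incl (X.jA a) = X.W.ι₁ ⟨X.cS.incl a.1,
      SplitPiece.g₁_mem X.Dσ X.pS X.hD₁ ⟨a.1, by rw [mem_puncture, X.hD₁]; exact a.2⟩⟩ := by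
  change X.bdry.incl (X.Ψ (X.jA a)) = _
  rw [X.hΨA a]
  exact SplitPiece.boundaryMap_inl X.Dσ X.pS X.pT X.hD₁ X.hD₂ X.W (Nat.succ_ne_zero n) _

/-- The boundary inclusion of the glued null-cobordism on the `T`-part of `M_U`:
`incl_U (jB b) = ι₂ (incl_T b)`. [folklore] -/
theorem glued_incl_jB (b : ↥(puncture X.iT)) :
    X.glued.incl (X.jB b) = X.W.ι₂ ⟨X.cT.incl b.1,
      SplitPiece.g₂_mem X.Dσ X.pT X.hD₂ ⟨b.1, by rw [mem_puncture, X.hD₂]; exact b.2⟩⟩ := by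
  change X.bdry.incl (X.Ψ (X.jB b)) = _
  rw [X.hΨB b]
  exact SplitPiece.boundaryMap_inr X.Dσ X.pS X.pT X.hD₁ X.hD₂ X.W (Nat.succ_ne_zero n) _

/-! ### The two pieces of the glued null-cobordism -/

/-- The `S`-piece `W_S ∖ {k_S 0}` of the glued null-cobordism. [folklore] -/
def pieceS : Piece X.cS X.glued where
  A := puncture X.kS
  j := ⟨X.W.ι₁, X.W.h₁.isEmbedding.continuous⟩
  isOpenEmbedding_j := ⟨X.W.h₁.isEmbedding, X.W.h₁o⟩
  mem_boundary_iff x := by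
    change (x : X.cS.W) ∈ _ ↔ X.W.ι₁ x ∈ (𝓡∂ (n + 2)).boundary X.P
    rw [mem_boundary_iff_of_isSmoothEmbedding X.W.h₁ X.W.h₁o x, mem_boundary_opens_iff]

/-- The `T`-piece `W_T ∖ {k_T 0}` of the glued null-cobordism. [folklore] -/
def pieceT : Piece X.cT X.glued where
  A := puncture X.kT
  j := ⟨X.W.ι₂, X.W.h₂.isEmbedding.continuous⟩
  isOpenEmbedding_j := ⟨X.W.h₂.isEmbedding, X.W.h₂o⟩
  mem_boundary_iff x := by
    change (x : X.cT.W) ∈ _ ↔ X.W.ι₂ x ∈ (𝓡∂ (n + 2)).boundary X.P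
    rw [mem_boundary_iff_of_isSmoothEmbedding X.W.h₂ X.W.h₂o x, mem_boundary_opens_iff]

/-- The half-disc points of positive norm are in the punctured piece. [cite: Juhasz2023, Def. 1.47] -/
theorem kS_mem_puncture {v : EuclideanHalfSpace (n + 2)} (hv : 0 < ‖v.val‖) :
    X.kS v ∈ puncture X.kS := by
  rw [mem_puncture]
  intro h
  have h0 : v = 0 := X.pS.k_injective h
  rw [h0] at hv
  have h00 : (0 : EuclideanHalfSpace (n + 2)).val = 0 := rfl
  rw [h00, norm_zero] at hv
  exact lt_irrefl 0 hv

/-- The half-disc points of positive norm are in the punctured piece. [cite: Juhasz2023, Def. 1.47] -/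
theorem kT_mem_puncture {v : EuclideanHalfSpace (n + 2)} (hv : 0 < ‖v.val‖) :
    X.kT v ∈ puncture X.kT := by
  rw [mem_puncture]
  intro h
  have h0 : v = 0 := X.pT.k_injective h
  rw [h0] at hv
  have h00 : (0 : EuclideanHalfSpace (n + 2)).val = 0 := rfl
  rw [h00, norm_zero] at hv
  exact lt_irrefl 0 hv

/-- A point `k_S v`, `0 < ‖v‖ < 1`, of the first piece is glued to a point of the second piece.
[cite: Juhasz2023, Def. 1.47] -/
theorem ι₁_kS_mem_range_ι₂ {v : EuclideanHalfSpace (n + 2)} (hv : 0 < ‖v.val‖) (hv1 : ‖v.val‖ < 1) :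
    X.W.ι₁ ⟨X.kS v, X.kS_mem_puncture hv⟩ ∈ range X.W.ι₂ := by
  -- `v = dilate ‖v‖ u` with `u = ‖v‖⁻¹ • v` a unit vector
  set t : ℝ := ‖v.val‖ with ht
  let u : EuclideanHalfSpace (n + 2) := EuclideanHalfSpace.dilate t⁻¹ v
  have hu : ‖u.val‖ = 1 := by
    change ‖(EuclideanHalfSpace.dilate t⁻¹ v).val‖ = 1
    rw [EuclideanHalfSpace.val_dilate_of_nonneg (inv_nonneg.2 hv.le), norm_smul,
      Real.norm_of_nonneg (inv_nonneg.2 hv.le), ← ht, inv_mul_cancel₀ hv.ne']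
  have hvu : v = EuclideanHalfSpace.dilate t u := by
    change v = EuclideanHalfSpace.dilate t (EuclideanHalfSpace.dilate t⁻¹ v)
    rw [EuclideanHalfSpace.dilate_dilate hv.le (inv_nonneg.2 hv.le), mul_inv_cancel₀ hv.ne',
      EuclideanHalfSpace.dilate_one]
  have hc : X.kT (EuclideanHalfSpace.dilate (1 - t) u) ∈ puncture X.kT := by
    refine X.kT_mem_puncture ?_
    rw [EuclideanHalfSpace.norm_val_dilate (by linarith) hu]
    linarith
  refine ⟨⟨_, hc⟩, ((X.W.rel _ _).2 ⟨u, t, hu, ⟨hv, hv1⟩, ?_, rfl⟩).symm⟩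
  change X.kS v = X.kS (EuclideanHalfSpace.dilate t u)
  rw [← hvu]

/-- Conversely, a glued point of the first piece is `k_S v` with `0 < ‖v‖ < 1`.
[cite: Juhasz2023, Def. 1.47] -/
theorem exists_eq_kS_of_mem_range (a : ↥(puncture X.kS)) (ha : X.W.ι₁ a ∈ range X.W.ι₂) :
    ∃ v : EuclideanHalfSpace (n + 2), 0 < ‖v.val‖ ∧ ‖v.val‖ < 1 ∧ (a : X.cS.W) = X.kS v := by
  obtain ⟨c, hc⟩ := ha
  exact boundaryConnectedSumRel.exists_eq_apply ((X.W.rel a c).1 hc.symm)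

/-! ### The interior overlap is an open half-ball -/

/-- The open unit half-ball `{‖v‖ < 1, v₀ > 0}` of `ℝⁿ⁺²` (parametrising the interior overlap of
the two pieces). [cite: Juhasz2023, Def. 1.47] -/
def halfBall (n : ℕ) : Set (EuclideanSpace ℝ (Fin (n + 2))) := {v | ‖v‖ < 1 ∧ 0 < v 0}

/-- The open unit half-ball is convex. [folklore] -/
theorem convex_halfBall : Convex ℝ (halfBall n) := by
  have h1 : Convex ℝ {v : EuclideanSpace ℝ (Fin (n + 2)) | ‖v‖ < 1} := by
    have h := convex_ball (0 : EuclideanSpace ℝ (Fin (n + 2))) 1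
    have he : Metric.ball (0 : EuclideanSpace ℝ (Fin (n + 2))) 1 = {v | ‖v‖ < 1} := by
      ext v; simp
    rwa [he] at h
  have h2 : Convex ℝ {v : EuclideanSpace ℝ (Fin (n + 2)) | 0 < v 0} :=
    convex_halfSpace_gt (EuclideanSpace.proj (0 : Fin (n + 2))).isLinear 0
  exact h1.inter h2

/-- The open unit half-ball is nonempty (`½ e₀` lies in it). [folklore] -/
theorem halfBall_nonempty : (halfBall n).Nonempty := by
  refine ⟨EuclideanSpace.single (0 : Fin (n + 2)) (1 / 2 : ℝ), ?_, ?_⟩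
  · rw [PiLp.norm_single]; norm_num
  · change (0 : ℝ) < EuclideanSpace.single (0 : Fin (n + 2)) (1 / 2 : ℝ) 0
    rw [PiLp.single_apply, if_pos rfl]; norm_num

/-- The open unit half-ball is contractible. [folklore] -/
instance contractibleSpace_halfBall : ContractibleSpace ↥(halfBall n) :=
  (convex_halfBall (n := n)).contractibleSpace halfBall_nonempty

/-- The open unit half-ball is connected. [folklore] -/
instance connectedSpace_halfBall : ConnectedSpace ↥(halfBall n) :=
  isConnected_iff_connectedSpace.1 ((convex_halfBall (n := n)).isConnected halfBall_nonempty)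

/-- The open unit half-ball is nonempty (instance). [folklore] -/
instance nonempty_halfBall : Nonempty ↥(halfBall n) := halfBall_nonempty.to_subtype

/-- A point of the half-ball as a point of the closed half space. [folklore] -/
abbrev toHalfSpace (v : ↥(halfBall n)) : EuclideanHalfSpace (n + 2) := ⟨v.1, v.2.2.le⟩

/-- `toHalfSpace` is a topological embedding. [folklore] -/
theorem isEmbedding_toHalfSpace : IsEmbedding (toHalfSpace (n := n)) :=
  (IsEmbedding.subtypeVal (p := fun v => v ∈ halfBall n)).codRestrict
    {x : EuclideanSpace ℝ (Fin (n + 2)) | 0 ≤ x 0} fun v => v.2.2.le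

/-- Points of the half-ball have positive norm. [folklore] -/
theorem norm_pos_of_mem_halfBall (v : ↥(halfBall n)) : 0 < ‖(toHalfSpace v).val‖ := by
  refine norm_pos_iff.2 fun h => ?_
  have h0 : (v.1 : EuclideanSpace ℝ (Fin (n + 2))) 0 = 0 := by
    change (toHalfSpace v).val 0 = 0
    rw [h]; rfl
  exact v.2.2.ne' h0

/-- **The parametrisation of the interior overlap**: `v ↦ ι₁ (k_S v)` on the open unit half-ball.
[cite: Juhasz2023, Def. 1.47] -/
def θ (v : ↥(halfBall n)) : X.P :=
  X.W.ι₁ ⟨X.kS (toHalfSpace v), X.kS_mem_puncture (norm_pos_of_mem_halfBall v)⟩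

/-- The parametrisation is a topological embedding. [folklore] -/
theorem isEmbedding_θ : IsEmbedding X.θ := by
  have h1 : IsEmbedding fun v : ↥(halfBall n) =>
      (⟨X.kS (toHalfSpace v), X.kS_mem_puncture (norm_pos_of_mem_halfBall v)⟩ : ↥(puncture X.kS)) :=
    (X.isSmoothEmbedding_kS.1.isEmbedding.comp isEmbedding_toHalfSpace).codRestrict _ _
  exact X.W.h₁.isEmbedding.comp h1

/-- The parametrisation lands in the overlap of the two pieces. [cite: Juhasz2023, Def. 1.47] -/
theorem θ_mem_inter (v : ↥(halfBall n)) : X.θ v ∈ range X.W.ι₁ ∩ range X.W.ι₂ :=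
  ⟨⟨_, rfl⟩, X.ι₁_kS_mem_range_ι₂ (norm_pos_of_mem_halfBall v) v.2.1⟩

/-- The parametrisation lands in the interior of `W_U`. [cite: Juhasz2023, Def. 1.47] -/
theorem θ_mem_interior (v : ↥(halfBall n)) : X.θ v ∈ (𝓡∂ (n + 2)).interior X.P := by
  rw [← ModelWithCorners.compl_boundary, mem_compl_iff, θ,
    mem_boundary_iff_of_isSmoothEmbedding X.W.h₁ X.W.h₁o, mem_boundary_opens_iff]
  change X.kS (toHalfSpace v) ∉ (𝓡∂ (n + 2)).boundary X.cS.W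
  rw [halfDisc_mem_boundary_iff X.isSmoothEmbedding_kS.1 X.isSmoothEmbedding_kS.2]
  exact v.2.2.ne'

/-- **Every interior point of the overlap is parametrised.** [cite: Juhasz2023, Def. 1.47] -/
theorem exists_θ_eq {p : X.P} (hp : p ∈ range X.W.ι₁ ∩ range X.W.ι₂)
    (hpi : p ∈ (𝓡∂ (n + 2)).interior X.P) : ∃ v, X.θ v = p := by
  obtain ⟨⟨a, rfl⟩, ha⟩ := hp
  obtain ⟨w, hw0, hw1, haw⟩ := X.exists_eq_kS_of_mem_range a ha
  have hwi : 0 < w.val 0 := by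
    refine lt_of_le_of_ne w.2 fun h => ?_
    rw [← ModelWithCorners.compl_boundary, mem_compl_iff,
      mem_boundary_iff_of_isSmoothEmbedding X.W.h₁ X.W.h₁o, mem_boundary_opens_iff, haw,
      halfDisc_mem_boundary_iff X.isSmoothEmbedding_kS.1 X.isSmoothEmbedding_kS.2] at hpi
    exact hpi h.symm
  refine ⟨⟨w.val, hw1, hwi⟩, ?_⟩
  rw [θ]
  congr 1
  exact Subtype.ext haw.symm

/-! ### The gluing datum of the two pieces -/

/-- **The gluing of the two punctured pieces** of the boundary connected sum, in the form of
`BCSOrientationGluing.lean`. [cite: KervaireMilnorAnnals1963, §2 p. 508] -/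
def gluing : BCSGluing X.cS X.cT X.glued where
  S := X.pieceS
  T := X.pieceT
  union_range := X.W.cover
  overlap_nonempty := by
    obtain ⟨v⟩ := (inferInstance : Nonempty ↥(halfBall n))
    exact ⟨⟨X.θ v, X.θ_mem_interior v⟩, X.θ_mem_inter v⟩
  isPreconnected_overlap := by
    have hc : Continuous fun v : ↥(halfBall n) => (⟨X.θ v, X.θ_mem_interior v⟩ : X.glued.Interior) :=
      InteriorManifold.continuous_iff_comp_val.2 X.isEmbedding_θ.continuous
    have hr : {v : X.glued.Interior | v.val ∈ range X.pieceS.j ∩ range X.pieceT.j} =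
        range fun v : ↥(halfBall n) => (⟨X.θ v, X.θ_mem_interior v⟩ : X.glued.Interior) := by
      ext u
      constructor
      · intro hu
        obtain ⟨v, hv⟩ := X.exists_θ_eq hu u.val_mem_interior
        exact ⟨v, InteriorManifold.val_injective hv⟩
      · rintro ⟨v, rfl⟩
        exact X.θ_mem_inter v
    rw [hr]
    exact isPreconnected_range hc

/-- Unfolding: the `S`-piece of the gluing. [folklore] -/
@[simp] theorem gluing_S : X.gluing.S = X.pieceS := rfl

/-- Unfolding: the `T`-piece of the gluing. [folklore] -/
@[simp] theorem gluing_T : X.gluing.T = X.pieceT := rfl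

/-- Points of the image of the parametrisation are interior points. [folklore] -/
theorem mem_interior_of_mem_range_θ {p : X.P} (hp : p ∈ range X.θ) : p ∈ (𝓡∂ (n + 2)).interior X.P := by
  obtain ⟨v, rfl⟩ := hp
  exact X.θ_mem_interior v

/-- Points of the image of the parametrisation are in the overlap. [folklore] -/
theorem mem_inter_of_mem_range_θ {p : X.P} (hp : p ∈ range X.θ) : p ∈ range X.W.ι₁ ∩ range X.W.ι₂ := by
  obtain ⟨v, rfl⟩ := hp
  exact X.θ_mem_inter v

/-- Interior points of the overlap are in the image of the parametrisation. [folklore] -/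
theorem mem_range_θ {p : X.P} (hp : p ∈ range X.W.ι₁ ∩ range X.W.ι₂)
    (hpi : p ∈ (𝓡∂ (n + 2)).interior X.P) : p ∈ range X.θ := by
  obtain ⟨v, hv⟩ := X.exists_θ_eq hp hpi
  exact ⟨v, hv⟩

/-- The image of the parametrisation as a subspace of `P` is the interior overlap read in
`int W_U`. [folklore] -/
def rangeθHomeo :
    ↥(range X.θ) ≃ₜ
      ↥{z : ManifoldInterior (n + 1) X.glued.W | z.1 ∈ range X.gluing.S.j ∩ range X.gluing.T.j} where
  toFun p := ⟨⟨p.1, X.mem_interior_of_mem_range_θ p.2⟩, X.mem_inter_of_mem_range_θ p.2⟩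
  invFun z := ⟨z.1.1, X.mem_range_θ z.2 z.1.2⟩
  left_inv _ := rfl
  right_inv _ := rfl
  continuous_toFun := (continuous_subtype_val.subtype_mk _).subtype_mk _
  continuous_invFun := (continuous_subtype_val.comp continuous_subtype_val).subtype_mk _

/-- **The interior overlap of the two pieces is homeomorphic to the open unit half-ball**, hence
contractible. [cite: Juhasz2023, Def. 1.47] -/
def overlapHomeo :
    ↥(halfBall n) ≃ₜ
      ↥{z : ManifoldInterior (n + 1) X.glued.W | z.1 ∈ range X.gluing.S.j ∩ range X.gluing.T.j} :=
  X.isEmbedding_θ.toHomeomorph.trans X.rangeθHomeo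

/-- The interior overlap is contractible. [cite: Juhasz2023, Def. 1.47] -/
theorem contractibleSpace_overlap :
    ContractibleSpace
      ↥{z : ManifoldInterior (n + 1) X.glued.W | z.1 ∈ range X.gluing.S.j ∩ range X.gluing.T.j} :=
  X.overlapHomeo.contractibleSpace_iff.1 inferInstance

/-! ### The punctures are boundary points; glued points lie in the collars -/

/-- The `S`-piece contains the interior of `W_S`. [folklore] -/
theorem containsS (x : X.cS.W) (hx : x ∈ (𝓡∂ (n + 1 + 1)).interior X.cS.W) : x ∈ X.gluing.S.A := by
  change x ∈ puncture X.kS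
  rw [mem_puncture]
  rintro rfl
  have hb : X.kS 0 ∈ (𝓡∂ (n + 2)).boundary X.cS.W := by
    have h0 : X.kS 0 = X.cS.incl (X.iS 0) := X.pS.k_zero
    rw [h0]
    exact X.cS.incl_mem_boundary _
  rw [← ModelWithCorners.compl_boundary] at hx
  exact hx hb

/-- The `T`-piece contains the interior of `W_T`. [folklore] -/
theorem containsT (x : X.cT.W) (hx : x ∈ (𝓡∂ (n + 1 + 1)).interior X.cT.W) : x ∈ X.gluing.T.A := by
  change x ∈ puncture X.kT
  rw [mem_puncture]
  rintro rfl
  have hb : X.kT 0 ∈ (𝓡∂ (n + 2)).boundary X.cT.W := by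
    have h0 : X.kT 0 = X.cT.incl (X.iT 0) := X.pT.k_zero
    rw [h0]
    exact X.cT.incl_mem_boundary _
  rw [← ModelWithCorners.compl_boundary] at hx
  exact hx hb

/-- Glued points of the `S`-piece lie in the collar of `W_S`. [cite: Hirsch1976, §4.6] -/
theorem collarS (x : X.gluing.S.A) (hx : X.gluing.S.j x ∈ range X.gluing.T.j) :
    (x : X.cS.W) ∈ X.cS.collarNhd X.κS 1 := by
  obtain ⟨v, -, -, hv⟩ := X.exists_eq_kS_of_mem_range x hx
  rw [hv]
  exact X.kS_mem_collarNhd v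

/-- Glued points of the `T`-piece lie in the collar of `W_T`. [cite: Hirsch1976, §4.6] -/
theorem collarT (y : X.gluing.T.A) (hy : X.gluing.T.j y ∈ range X.gluing.S.j) :
    (y : X.cT.W) ∈ X.cT.collarNhd X.κT 1 := by
  obtain ⟨a, ha⟩ := hy
  obtain ⟨v, t, hv, ht, -, hb⟩ := (X.W.rel a y).1 ha
  rw [hb]
  exact X.kT_mem_collarNhd _

/-! ### The boundary links -/

/-- **The boundary link on the `S` side**: the gluing map `jA : M_S ∖ pt → M_U` of `M_U` is the
boundary map of the `S`-piece. [cite: KervaireMilnorAnnals1963, §2 p. 508] -/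
def linkS : X.gluing.S.BdryLink where
  A' := puncture X.iS
  j' := X.jA
  incl_mem s := SplitPiece.g₁_mem X.Dσ X.pS X.hD₁ ⟨s.1, by rw [mem_puncture, X.hD₁]; exact s.2⟩
  sq s := X.glued_incl_jA s
  contMDiff := X.hjA.contMDiff.of_le (by exact_mod_cast le_top)
  injective := X.hjA.isEmbedding.injective
  det_ne_zero s := det_mfderiv_ne_zero_of_isSmoothEmbedding X.hjA X.hjAo s

/-- **The boundary link on the `T` side**. [cite: KervaireMilnorAnnals1963, §2 p. 508] -/
def linkT : X.gluing.T.BdryLink where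
  A' := puncture X.iT
  j' := X.jB
  incl_mem s := SplitPiece.g₂_mem X.Dσ X.pT X.hD₂ ⟨s.1, by rw [mem_puncture, X.hD₂]; exact s.2⟩
  sq s := X.glued_incl_jB s
  contMDiff := X.hjB.contMDiff.of_le (by exact_mod_cast le_top)
  injective := X.hjB.isEmbedding.injective
  det_ne_zero s := det_mfderiv_ne_zero_of_isSmoothEmbedding X.hjB X.hjBo s

/-- The punctured disc domain `M_S ∖ {i_S 0}` is nonempty (`i_S` is injective on `ℝⁿ⁺¹`).
[folklore] -/
theorem nonempty_linkS_A' : Nonempty X.linkS.A' := by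
  refine ⟨⟨X.iS (EuclideanSpace.single (0 : Fin (n + 1)) (1 : ℝ)), ?_⟩⟩
  change X.iS _ ∈ puncture X.iS
  rw [mem_puncture]
  intro h
  have h1 := congrArg (fun v : EuclideanSpace ℝ (Fin (n + 1)) => v 0) (X.hiS.isEmbedding.injective h)
  simp at h1

/-- The punctured disc domain `M_T ∖ {i_T 0}` is nonempty. [folklore] -/
theorem nonempty_linkT_A' : Nonempty X.linkT.A' := by
  refine ⟨⟨X.iT (EuclideanSpace.single (0 : Fin (n + 1)) (1 : ℝ)), ?_⟩⟩
  change X.iT _ ∈ puncture X.iT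
  rw [mem_puncture]
  intro h
  have h1 := congrArg (fun v : EuclideanSpace ℝ (Fin (n + 1)) => v 0) (X.hiT.isEmbedding.injective h)
  simp at h1

/-- Unfolding. [folklore] -/
@[simp] theorem linkS_A' : X.linkS.A' = puncture X.iS := rfl
/-- Unfolding. [folklore] -/
@[simp] theorem linkS_j' : X.linkS.j' = X.jA := rfl
/-- Unfolding. [folklore] -/
@[simp] theorem linkT_A' : X.linkT.A' = puncture X.iT := rfl
/-- Unfolding. [folklore] -/
@[simp] theorem linkT_j' : X.linkT.j' = X.jB := rfl

end BCSSetup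

end NullCobordism

/-! ### Existence from an oriented connected sum -/

namespace HomotopySphere

variable {n : ℕ}

/-- A homotopy sphere is nonempty. [folklore] -/
theorem nonempty_carrier (S : HomotopySphere (n + 1)) : Nonempty S.carrier :=
  ⟨(Classical.choice S.nonempty_homotopyEquiv).invFun
    ⟨EuclideanSpace.single (0 : Fin (n + 1 + 1)) (1 : ℝ), by simp [PiLp.norm_single]⟩⟩

/-- **The boundary connected sum of two null-cobordisms of homotopy spheres exists in packaged
form** (Kervaire–Milnor 1963, §2 p. 508, with Lemma 2.2's Addendum `b(W₁ ♮ W₂) = M₁ # M₂`): for an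
oriented connected sum `U = S # T` and null-cobordisms `W_S`, `W_T` of `S`, `T` there is a
`BCSModel` — `W_U = W_S ♮ W_T` bounding `U`, glued from the punctured pieces along collar
half-discs over the discs of `U`, whose boundary links are the gluing maps of `U`.
[cite: KervaireMilnorAnnals1963, §2 p. 508] -/
theorem nonempty_bcsModel (S T U : HomotopySphere (n + 1))
    (h : IsOrientedConnectedSum S.orientation T.orientation U.orientation)
    (cS : NullCobordism (n + 1) S.carrier) (cT : NullCobordism (n + 1) T.carrier) :
    Nonempty (BCSModel S T U cS cT) := by
  obtain ⟨i₁, i₂, o₀, jA', jB', hi₁, hi₂, -, -, ⟨hjA', hjA'o, hjB', hjB'o, hcov', hrel'⟩, hopA, hopB⟩ := h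
  -- charts of `S`, `T` inverting the discs
  obtain ⟨e₁, he₁, ht₁, hse₁⟩ := ConnectedSumData.exists_of_isSmoothEmbedding hi₁
  obtain ⟨e₂, he₂, ht₂, hse₂⟩ := ConnectedSumData.exists_of_isSmoothEmbedding hi₂
  subst hse₁ hse₂
  let Dσ : ConnectedSumData (n + 1) S.carrier T.carrier := ⟨e₁, e₂, he₁, he₂, ht₁, ht₂⟩
  haveI : Nonempty S.carrier := S.nonempty_carrier
  haveI : Nonempty T.carrier := T.nonempty_carrier
  -- collars and collar half-discs
  obtain ⟨κS⟩ := BoundaryData.nonempty_collar_of_compactSpace n cS.W cS.boundaryData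
  obtain ⟨κT⟩ := BoundaryData.nonempty_collar_of_compactSpace n cT.W cT.boundaryData
  have hkS := κS.isSmoothEmbedding_halfDisc hi₁ (isOpen_range_of_isSmoothEmbedding_disc hi₁)
  have hkT := κT.isSmoothEmbedding_halfDisc hi₂ (isOpen_range_of_isSmoothEmbedding_disc hi₂)
  -- the gluing `W_S ♮ W_T`
  obtain ⟨P, _, _, _, _, _, hglue⟩ :=
    (HalfDiscPair.mk (κS.halfDisc ⇑e₁.symm) (κT.halfDisc ⇑e₂.symm) hkS.1 hkS.2 hkT.1 hkT.2).exists_isOpenGluing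
  haveI : CompactSpace P := compactSpace_of_isOpenGluing_boundaryConnectedSumRel_holds (n + 2) cS.W cT.W P
    _ _ hkS.1 hkS.2 hkT.1 hkT.2 hglue
  obtain ⟨W⟩ := HalfGluing.nonempty_of_isOpenGluing hglue
  -- `U ≅ S # T` compatibly with the gluing maps
  obtain ⟨Ψ, hΨA, hΨB⟩ := IsOpenGluing.exists_diffeomorph_comp_eq
    (IP := 𝓡 (n + 1)) (IP' := 𝓘(ℝ, EuclideanSpace ℝ (Fin (n + 1)))) (P := U.carrier)
    (P' := (Dσ.glueData (Nat.succ_ne_zero n)).Glued)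
    hjA' hjA'o hjB' hjB'o hcov' hrel'
    (Dσ.glueData (Nat.succ_ne_zero n)).isSmoothEmbedding_inl (Dσ.glueData (Nat.succ_ne_zero n)).isOpen_range_inl
    (Dσ.glueData (Nat.succ_ne_zero n)).isSmoothEmbedding_inr (Dσ.glueData (Nat.succ_ne_zero n)).isOpen_range_inr
    (Dσ.glueData (Nat.succ_ne_zero n)).range_inl_union_range_inr
    (fun a b => Dσ.inl_eq_inr_iff_connectedSumRel (Nat.succ_ne_zero n) a b)
  let X : NullCobordism.BCSSetup n :=
    { MS := S.carrier
      MT := T.carrier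
      MU := U.carrier
      cS := cS
      cT := cT
      κS := κS
      κT := κT
      iS := ⇑e₁.symm
      iT := ⇑e₂.symm
      hiS := hi₁
      hiT := hi₂
      P := P
      W := W
      Dσ := Dσ
      hD₁ := rfl
      hD₂ := rfl
      jA := jA'
      jB := jB'
      hjA := hjA'
      hjAo := hjA'o
      hjB := hjB'
      hjBo := hjB'o
      Ψ := Ψ
      hΨA := hΨA
      hΨB := hΨB }
  refine ⟨?_⟩
  exact
    { κS := κS
      κT := κT
      cU := X.glued
      G := X.gluing
      LS := X.linkS
      LT := X.linkT
      hopS := hopA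
      hopT := hopB
      nonempty_linkS := X.nonempty_linkS_A'
      nonempty_linkT := X.nonempty_linkT_A'
      containsS := X.containsS
      containsT := X.containsT
      collarS := X.collarS
      collarT := X.collarT
      contractible_overlap := X.contractibleSpace_overlap }

end HomotopySphere

end Literature.Topology.FourManifolds
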